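import Summits.HubbardSuperconductivity.HubbardSuperconductivity.Theses.ParityGapRigidity
import Summits.HubbardSuperconductivity.HubbardSuperconductivity.Theorems.NoGoSingletPairSpinAlgebra
import Literature.MathematicalPhysics.QuantumLattice.HubbardRingPerronFrobeniusProofs

/-!
# Route ParityGapRigidity — crux `IncommensurateRigidity` (stmt-HubbardSuperconductivity-2195):
# what hypothesis (H2) says about the total spin of a sector ground state

Helper file (`--supports stmt-HubbardSuperconductivity-2195`, line `registered`, lead c8). The crux's
hypothesis (H2) ("normal fluctuations") bounds `Re⟨A†A⟩_ψ − |⟨A⟩_ψ|² ≤ C·L²` for EVERY one-body operator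
`A = Σ_p a(p) c†_{p₁} c_{p₂}` with `|a| ≤ 1` supported on pairs at torus distance `≤ 1`. Taking `a` the
indicator of the on-site spin-flip pairs `((x,↑),(x,↓))` makes `A = S⁺ = Σ_x c†_{x↑}c_{x↓}`; on the
`S^z = 0` sector `⟨S⁺⟩_ψ = 0` (distinct `(N↑,N↓)` sectors are orthogonal) and
`S⁻S⁺ = S⃗² − (S^z)² − S^z` acts as `S⃗²`, so (H2) forces

  `Re ⟨ψ, S⃗² ψ⟩ ≤ C · L²`

for every normalised `(N_L, 0)`-sector ground state (`re_expect_spinSq_le_of_normalFluctuationsAt`,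
packaged over the crux's verbatim (H2) in `spinSq_le_of_normalFluctuations`; eigenvalue form
`spinSq_eigenvalue_le_of_normalFluctuationsAt`: a ground state of total spin `S` needs `S(S+1) ≤ C L²`).
This is the exact form of the route reviewers' remark that (H2) excludes Nagaoka-type (saturated,
`S ~ L²`) sector ground states while `S = O(L)` passes; it is a necessary condition any window
verifying (H2) (item `GappedWindow`) must meet. Nothing here bears on the open stub
`stub_kohnStiffnessFC` (see `Cruxes/IncommensurateRigidity/Lines/registered-dead*.md`).

No definitions are introduced (the spin-flip coefficient is the explicit indicator
`fun p => if p ∈ univ.image (fun x => ((x,↑),(x,↓))) then 1 else 0`). Reused, never redefined: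
`spinPlus`, `spinSq`, `HubbardWave0.spinZ`, `IsInSector`, `upPart`, `downPart` (Lieb sector API),
`LiebThm1.raisesSpin_spinPlus`, `LiebThm1.spinZ_mulVec_of_isInSector`,
`Summit.HubbardSuperconductivity.NoGo.spinMinus_mul_spinPlus_eq` (`S⁻S⁺ = S² − (S^z)² − S^z`),
`mem_szSector_two_mul_zero_iff`. Sources: E. H. Lieb, PRL 62 (1989) 1201 (sectors, spin operators);
H. Tasaki, *Physics and Mathematics of Quantum Many-Body Systems* (2020) §2.4, §9.3. All statements
are folklore consequences of the CAR and the `su(2)` relations.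
-/

noncomputable section

namespace Summit.HubbardSuperconductivity.IncommensurateRigidity.Birth

open scoped BigOperators Matrix
open Matrix Literature.MathematicalPhysics.QuantumLattice

section General

variable {Λ : Type*} [LinearOrder Λ] [Fintype Λ]

/-- The spin-flip indicator coefficient (`1` on the on-site pairs `((x,↑),(x,↓))`, `0` elsewhere)
is bounded by `1` (admissible for (H2)). [folklore] -/
theorem norm_flipCoeff_le (p : Orb Λ × Orb Λ) :
    ‖(if p ∈ (Finset.univ.image fun x : Λ => (orb x 0, orb x 1) : Finset (Orb Λ × Orb Λ))
        then (1 : ℂ) else 0)‖ ≤ 1 := by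
  split_ifs <;> simp

/-- A pair carrying a nonzero spin-flip coefficient is an on-site pair `((x,↑),(x,↓))`. [folklore] -/
theorem exists_eq_of_flipCoeff_ne_zero {p : Orb Λ × Orb Λ}
    (h : (if p ∈ (Finset.univ.image fun x : Λ => (orb x 0, orb x 1) : Finset (Orb Λ × Orb Λ))
        then (1 : ℂ) else 0) ≠ 0) :
    ∃ x : Λ, p = (orb x 0, orb x 1) := by
  split_ifs at h with hp
  · obtain ⟨x, -, rfl⟩ := Finset.mem_image.1 hp
    exact ⟨x, rfl⟩
  · exact absurd rfl h

/-- With the spin-flip indicator as coefficient, the one-body operator of (H2) is the spin-raising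
operator: `Σ_p a(p) c†_{p₁} c_{p₂} = S⁺ = Σ_x c†_{x↑} c_{x↓}`. Lieb, PRL 62 (1989) 1201. [folklore] -/
theorem sum_flipCoeff_smul :
    (∑ p : Orb Λ × Orb Λ,
        (if p ∈ (Finset.univ.image fun x : Λ => (orb x 0, orb x 1) : Finset (Orb Λ × Orb Λ))
          then (1 : ℂ) else 0) • (creation p.1 * annihilation p.2)) =
      (spinPlus : Matrix (Finset (Orb Λ)) (Finset (Orb Λ)) ℂ) := by
  have h1 : (∑ p : Orb Λ × Orb Λ,
        (if p ∈ (Finset.univ.image fun x : Λ => (orb x 0, orb x 1) : Finset (Orb Λ × Orb Λ))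
          then (1 : ℂ) else 0) • (creation p.1 * annihilation p.2)) =
      ∑ p : Orb Λ × Orb Λ,
        (if p ∈ (Finset.univ.image fun x : Λ => (orb x 0, orb x 1) : Finset (Orb Λ × Orb Λ)) then
          (creation p.1 * annihilation p.2 : Matrix (Finset (Orb Λ)) (Finset (Orb Λ)) ℂ) else 0) := by
    refine Finset.sum_congr rfl fun p _ => ?_
    split_ifs <;> simp
  have hinj : Set.InjOn (fun x : Λ => (orb x 0, orb x 1)) (Finset.univ : Finset Λ) := by
    intro x _ y _ h
    simpa using congrArg (fun q : Orb Λ × Orb Λ => (ofLex q.1).1) h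
  rw [h1, Finset.sum_ite_mem, Finset.univ_inter, Finset.sum_image hinj]
  rfl

/-- `⟨ψ, S⁺ ψ⟩ = 0` for a vector of a fixed `(N↑, N↓)` sector: `S⁺ψ` lies in the sector
`(N↑ + 1, N↓ − 1)`, orthogonal to `ψ`. Lieb, PRL 62 (1989) 1201, proof of Theorem 1. [folklore] -/
theorem star_dotProduct_spinPlus_mulVec_eq_zero {a b : ℕ} {ψ : Fock (Orb Λ)}
    (hψ : IsInSector a b ψ) :
    star ψ ⬝ᵥ (spinPlus *ᵥ ψ) = 0 := by
  rw [dotProduct]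
  refine Finset.sum_eq_zero fun s _ => ?_
  by_cases hs : (upPart s).card = a ∧ (downPart s).card = b
  · have hzero : (spinPlus *ᵥ ψ) s = 0 := by
      rw [mulVec, dotProduct]
      refine Finset.sum_eq_zero fun s' _ => ?_
      by_cases hM : (spinPlus : Matrix (Finset (Orb Λ)) (Finset (Orb Λ)) ℂ) s s' = 0
      · rw [hM, zero_mul]
      · have h1 := LiebThm1.raisesSpin_spinPlus s s' hM
        by_cases hs' : (upPart s').card = a ∧ (downPart s').card = b
        · exfalso
          omega
        · rw [hψ s' hs', mul_zero]
    rw [hzero, mul_zero]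
  · rw [Pi.star_apply, hψ s hs, star_zero, zero_mul]

/-- On the `S^z = 0` sector `(n, n)`, `⟨ψ, S⁻S⁺ ψ⟩ = ⟨ψ, S⃗² ψ⟩`
(`S⁻S⁺ = S⃗² − (S^z)² − S^z` and `S^z ψ = 0`). Tasaki (2020) §2.4, (2.4.9). [folklore] -/
theorem expect_conjTranspose_spinPlus_mul_spinPlus {n : ℕ} {ψ : Fock (Orb Λ)}
    (hψ : IsInSector n n ψ) :
    expect (spinPlusᴴ * spinPlus) ψ = expect spinSq ψ := by
  have hZ : HubbardWave0.spinZ *ᵥ ψ = 0 := by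
    rw [LiebThm1.spinZ_mulVec_of_isInSector hψ, sub_self, mul_zero, zero_smul]
  unfold expect
  rw [show ((spinPlus : Matrix (Finset (Orb Λ)) (Finset (Orb Λ)) ℂ)ᴴ) = spinMinus from rfl,
    Summit.HubbardSuperconductivity.NoGo.spinMinus_mul_spinPlus_eq, Matrix.sub_mulVec,
    Matrix.sub_mulVec, ← Matrix.mulVec_mulVec, hZ, Matrix.mulVec_zero, sub_zero, sub_zero]

/-- **(H2)-type variance bound at the spin-flip coefficient gives a total-spin bound** (abstract
form, any finite lattice `Λ`, any bound `B`): if a vector `ψ` of the `S^z = 0` sector `(n, n)` obeys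
`Re⟨A†A⟩_ψ − |⟨A⟩_ψ|² ≤ B` for the one-body operator `A` built from the spin-flip indicator, then
`Re ⟨ψ, S⃗² ψ⟩ ≤ B`. Lieb, PRL 62 (1989) 1201; Tasaki (2020) §2.4. [folklore] -/
theorem re_expect_spinSq_le_of_var {n : ℕ} {ψ : Fock (Orb Λ)} (hψ : IsInSector n n ψ) {B : ℝ}
    (h : (expect (Matrix.conjTranspose (∑ p : Orb Λ × Orb Λ,
          (if p ∈ (Finset.univ.image fun x : Λ => (orb x 0, orb x 1) : Finset (Orb Λ × Orb Λ))
            then (1 : ℂ) else 0) • (creation p.1 * annihilation p.2)) *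
        (∑ p : Orb Λ × Orb Λ,
          (if p ∈ (Finset.univ.image fun x : Λ => (orb x 0, orb x 1) : Finset (Orb Λ × Orb Λ))
            then (1 : ℂ) else 0) • (creation p.1 * annihilation p.2))) ψ).re -
      ‖expect (∑ p : Orb Λ × Orb Λ,
          (if p ∈ (Finset.univ.image fun x : Λ => (orb x 0, orb x 1) : Finset (Orb Λ × Orb Λ))
            then (1 : ℂ) else 0) • (creation p.1 * annihilation p.2)) ψ‖ ^ 2 ≤ B) :
    (expect spinSq ψ).re ≤ B := by
  have h0 : expect spinPlus ψ = 0 := star_dotProduct_spinPlus_mulVec_eq_zero hψ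
  rw [sum_flipCoeff_smul, expect_conjTranspose_spinPlus_mul_spinPlus hψ, h0, norm_zero,
    zero_pow two_ne_zero, sub_zero] at h
  exact h

end General

/-! ### The torus form consumed by the crux -/

/-- **(H2) at one vector bounds its total spin.** If a vector `ψ` of the sector `(N, S^z) = (2n, 0)`
of the `L × L` Hubbard torus satisfies the normal-fluctuation inequality of hypothesis (H2) of
`IncommensurateRigidity` (for every admissible one-body coefficient `a`), then
`Re ⟨ψ, S⃗² ψ⟩ ≤ C · L²`. Proof: take `a` = spin-flip indicator, so `A = S⁺`, `⟨S⁺⟩_ψ = 0` and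
`⟨S⁻S⁺⟩_ψ = ⟨S⃗²⟩_ψ`. Lieb, PRL 62 (1989) 1201; Tasaki (2020) §2.4. [folklore] -/
theorem re_expect_spinSq_le_of_normalFluctuationsAt {L : ℕ} {C : ℝ} {n : ℕ}
    {ψ : Fock (Orb (FermionTorus 2 L))} (hψ : ψ ∈ szSector (2 * n) 0)
    (h2 : ∀ a : Orb (FermionTorus 2 L) × Orb (FermionTorus 2 L) → ℂ, (∀ p, ‖a p‖ ≤ 1) →
      (∀ p, a p ≠ 0 → torusDist (ofLex p.1).1.toTorusSite (ofLex p.2).1.toTorusSite ≤ 1) →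
      (expect (Matrix.conjTranspose (∑ p, a p • (creation p.1 * annihilation p.2)) *
          (∑ p, a p • (creation p.1 * annihilation p.2))) ψ).re -
        ‖expect (∑ p, a p • (creation p.1 * annihilation p.2)) ψ‖ ^ 2 ≤ C * (L : ℝ) ^ 2) :
    (expect spinSq ψ).re ≤ C * (L : ℝ) ^ 2 :=
  re_expect_spinSq_le_of_var ((mem_szSector_two_mul_zero_iff n ψ).1 hψ)
    (h2 _ norm_flipCoeff_le fun p hp => by
      -- a pair carrying a nonzero spin-flip coefficient is on-site: torus distance `0 ≤ 1`
      obtain ⟨x, hx⟩ := exists_eq_of_flipCoeff_ne_zero hp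
      subst hx
      simp)

/-- **Eigenvalue form.** Under the same (H2) inequality, a normalised `(2n, 0)`-sector vector that
is an `S⃗²`-eigenvector with eigenvalue `λ` (e.g. `λ = S(S+1)` for total spin `S`) has `λ ≤ C · L²`:
saturated (Nagaoka-type, `S ~ L²`) sector ground states violate (H2), `S = O(L)` is allowed.
Lieb, PRL 62 (1989) 1201; Tasaki (2020) §2.4. [folklore] -/
theorem spinSq_eigenvalue_le_of_normalFluctuationsAt {L : ℕ} {C lam : ℝ} {n : ℕ}
    {ψ : Fock (Orb (FermionTorus 2 L))} (hψ : ψ ∈ szSector (2 * n) 0) (hnorm : star ψ ⬝ᵥ ψ = 1)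
    (hS : spinSq *ᵥ ψ = (lam : ℂ) • ψ)
    (h2 : ∀ a : Orb (FermionTorus 2 L) × Orb (FermionTorus 2 L) → ℂ, (∀ p, ‖a p‖ ≤ 1) →
      (∀ p, a p ≠ 0 → torusDist (ofLex p.1).1.toTorusSite (ofLex p.2).1.toTorusSite ≤ 1) →
      (expect (Matrix.conjTranspose (∑ p, a p • (creation p.1 * annihilation p.2)) *
          (∑ p, a p • (creation p.1 * annihilation p.2))) ψ).re -
        ‖expect (∑ p, a p • (creation p.1 * annihilation p.2)) ψ‖ ^ 2 ≤ C * (L : ℝ) ^ 2) :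
    lam ≤ C * (L : ℝ) ^ 2 := by
  have h := re_expect_spinSq_le_of_normalFluctuationsAt hψ h2
  unfold expect at h
  rw [hS, dotProduct_smul, hnorm, smul_eq_mul, mul_one, Complex.ofReal_re] at h
  exact h

/-- **(H2) of the crux bounds the total spin of every sector ground state, uniformly.** From the
crux's hypothesis (H2) at `(U, δ)`, verbatim: with the same constant `C` and threshold `L₀`, every
normalised `(N_L, 0)`-sector ground state `ψ` of `hubbardTorus 2 L 1 U`, `N_L = 2⌊(1-δ)L²/2⌋`, at even
`L ≥ L₀` has `Re ⟨ψ, S⃗² ψ⟩ ≤ C · L²`. Lieb, PRL 62 (1989) 1201; Tasaki (2020) §2.4. [folklore] -/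
theorem spinSq_le_of_normalFluctuations :
    ∀ (U δ : ℝ), (∃ C : ℝ, ∃ L₀ : ℕ, ∀ L ≥ L₀, Even L → ∀ Hm, Hm = hubbardTorus 2 L 1 U → ∀ ψ,
      IsGroundStateInSector Hm (2 * ⌊(1 - δ) * (L : ℝ) ^ 2 / 2⌋₊) 0 ψ → star ψ ⬝ᵥ ψ = 1 →
      ∀ a : Orb (FermionTorus 2 L) × Orb (FermionTorus 2 L) → ℂ, (∀ p, ‖a p‖ ≤ 1) →
        (∀ p, a p ≠ 0 → torusDist (ofLex p.1).1.toTorusSite (ofLex p.2).1.toTorusSite ≤ 1) →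
        (expect (Matrix.conjTranspose (∑ p, a p • (creation p.1 * annihilation p.2)) *
            (∑ p, a p • (creation p.1 * annihilation p.2))) ψ).re -
          ‖expect (∑ p, a p • (creation p.1 * annihilation p.2)) ψ‖ ^ 2 ≤ C * (L : ℝ) ^ 2) →
      ∃ C : ℝ, ∃ L₀ : ℕ, ∀ L ≥ L₀, Even L → ∀ Hm, Hm = hubbardTorus 2 L 1 U → ∀ ψ,
        IsGroundStateInSector Hm (2 * ⌊(1 - δ) * (L : ℝ) ^ 2 / 2⌋₊) 0 ψ → star ψ ⬝ᵥ ψ = 1 →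
        (expect spinSq ψ).re ≤ C * (L : ℝ) ^ 2 := by
  rintro U δ ⟨C, L₀, h⟩
  exact ⟨C, L₀, fun L hL hE Hm hHm ψ hgs hn =>
    re_expect_spinSq_le_of_normalFluctuationsAt hgs.1 (h L hL hE Hm hHm ψ hgs hn)⟩

end Summit.HubbardSuperconductivity.IncommensurateRigidity.Birth

end
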